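import Summits.BirchSwinnertonDyer.BirchSwinnertonDyer.Theses.ManinLocalTwoThree
import Literature.NumberTheory.EllipticCurves.ManinConstantModularDegree
import Literature.NumberTheory.EllipticCurves.ManinConstantSemistablePrimewise
import Literature.NumberTheory.EllipticCurves.CuspFormLFunctionLevelConductorProofs
import HarnessLib

/-!
# The ČNS odd-degree tooth at `2`: an ODD modular degree forces an ODD Manin constant (E-an-72 / E-an-72′, kernel edges)

Summit `BirchSwinnertonDyer`, route `ManinLocalTwoThree` (cell bsd-f2-manin), deciding crux C2 `ManinOddAtFour`
(stmt-BirchSwinnertonDyer-22967), line `kato_shift_two`, skeleton v10 stub `stub_blindOrbitMinimalResidual` (the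
orbit-minimal totally Kummer-blind residual).  The analytic planner (an g17, MEMO-an §59, HOME/an/Sketch-an-g17.lean
5ae25f8aecfcb1ed) observed that the printed bound of Česnavičius–Neururer–Saha (Thm. 1.2: `v₂(c) ≤ v₂(deg φ) + ε₂(N)` with
`ε₂(N) = 0` unless `8 ∣ N` and no prime `≡ 3 (mod 4)` divides `N`; tree fact `cesnaviciusNeururerSaha_thm_1_2`, cite-only)
bites EXACTLY on the tame part of that residual: all 55 totally-blind `X₀`-optimal classes with `4 ∥ N < 5·10⁵` (the family
`E'_m`, `N = 4(m² + 4)`) have odd modular degree (census HOME/an/g17-blind-degphi.out c9e2152afa62fc94).  This file lands the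
two kernel edges of that sketch (an's statements and proofs, verbatim up to namespace), as helpers on the crux:

* `not_two_dvd_maninConstant_of_cns_of_odd_deg` (E-an-72): ČNS Thm 1.2 → modularity → for ANY datum `D` at a level
  outside the exceptional clause at `2`, `Odd D.deg ⇒ 2 ∤ c`;
* `natAbs_maninConstant_eq_one_of_cns_of_mazur_of_odd_deg` (E-an-72′): with Mazur 1978 (a binder of C2) and no odd
  square dividing `N`, the lattice-optimal datum has `|c| = 1`.

CONDITIONAL on the printed facts (hypotheses by name); nothing about BSD or Manin's conjecture is proved; the parity law
E-an-73 («blind tame optimal ⇒ odd degree») that would feed these edges beyond the table is OPEN and not stated here.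
-/

set_option autoImplicit false
set_option linter.dupNamespace false

noncomputable section

open Literature.NumberTheory.EllipticCurves Literature.NumberTheory.EllipticCurves.ModularForms
open WeierstrassCurve

namespace Summit.BirchSwinnertonDyer.BirchSwinnertonDyer.Theorems.ManinLocalTwoThree

/-- **E-an-72 (kernel edge, an g17).**  Under ČNS Thm 1.2 (tree fact, cite-only) and modularity: for ANY parametrisation
datum `D` of a globally minimal `W` at a level `N` outside the printed exceptional clause at `2` (`8 ∤ N`, or some prime
`≡ 3 (mod 4)` divides `N`), an ODD modular degree forces an ODD Manin constant.  Optimality is not needed.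
[cite: CesnaviciusNeururerSaha2023, Thm. 1.2] -/
theorem not_two_dvd_maninConstant_of_cns_of_odd_deg
    (hcns : cesnaviciusNeururerSaha_thm_1_2) (hnf : exists_isNewformOf)
    (W : WeierstrassCurve ℚ) [W.IsElliptic] [W.IsGloballyMinimal] {N : ℕ} [NeZero N]
    (D : ModularParametrizationData W N)
    (hN : ¬ 2 ^ 3 ∣ N ∨ ∃ q : ℕ, q.Prime ∧ q ∣ N ∧ q % 4 = 3) (hodd : Odd D.deg) :
    ¬ (2 : ℤ) ∣ D.maninConstant := by
  have hlev : N = W.conductorNorm ℤ :=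
    IsNewformOf.level_eq_conductorNorm_of_exists_isNewformOf hnf D.isNewformOf
  subst hlev
  exact not_dvd_maninConstant_of_padicVal_le_of_not_dvd D Nat.prime_two
    (padicValInt_two_maninConstant_le_modularDegree hcns W D hN)
    (fun h2 => (Nat.not_even_iff_odd.mpr hodd) (even_iff_two_dvd.mpr h2))

/-- **E-an-72′ (kernel edge, an g17): `|c| = 1` outright.**  If moreover no ODD prime divides `N` to the second power
(e.g. `N = 4p`, `4pq`) and `D` is the lattice-optimal datum, Mazur's theorem (tree fact, a binder of C2) removes the odd
primes, so an odd degree gives `|c| = 1`. [cite: CesnaviciusNeururerSaha2023, Thm. 1.2] [cite: Mazur1978, Cor. 4.1] -/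
theorem natAbs_maninConstant_eq_one_of_cns_of_mazur_of_odd_deg
    (hcns : cesnaviciusNeururerSaha_thm_1_2) (hnf : exists_isNewformOf)
    (hmz : mazur_not_dvd_maninConstant_of_odd)
    (W : WeierstrassCurve ℚ) [W.IsElliptic] [W.IsGloballyMinimal] {N : ℕ} [NeZero N]
    (D : ModularParametrizationData W N)
    (hopt : ∀ z ∈ D.L.lattice, ∃ w ∈ periodLattice D.f, z = D.c * w)
    (hN : ¬ 2 ^ 3 ∣ N ∨ ∃ q : ℕ, q.Prime ∧ q ∣ N ∧ q % 4 = 3)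
    (hsq : ∀ q : ℕ, q.Prime → q ≠ 2 → ¬ q ^ 2 ∣ N) (hodd : Odd D.deg) :
    D.maninConstant.natAbs = 1 := by
  have h2 := not_two_dvd_maninConstant_of_cns_of_odd_deg hcns hnf W D hN hodd
  refine Nat.eq_one_iff_not_exists_prime_dvd.mpr fun q hq hqc => ?_
  have hqc' : (q : ℤ) ∣ D.maninConstant := Int.natCast_dvd.mpr hqc
  by_cases hq2 : q = 2
  · subst hq2; exact h2 hqc'
  · exact hmz W D hopt q hq hq2 (hsq q hq hq2) hqc'

end Summit.BirchSwinnertonDyer.BirchSwinnertonDyer.Theorems.ManinLocalTwoThree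

end
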